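import Summits.CriticalPhenomena.Ising3DConformalLimit.Theorems.PlantedPinningGaussianPinningSaturationDefs

/-!
# Line `birth` for crux `GaussianPinningSaturation` (stmt-CriticalPhenomena-8452): stub B from its parts

Lead seat c1 (`prover-line-stmt-CriticalPhenomena-8452-c1-0`), route `PlantedPinning`, sub-problem
`Ising3DConformalLimit`. RESHAPE of stub B `TwoPointSaturation` (liminf_{p→0} liminf_L e^{lin} ≥ 1)
along the exact Riccati bookkeeping of the linear pinning flow `v_j = linVar L j`:

  B ⟸ B1 `BoxSusceptibilityFloor` ∧ B2 `LinRiccatiSaturation`   (`twoPointSaturation_of_floor_of_riccati`,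
  = registered bookkeeping stub `stub_twoPointSaturationOfParts`).

With `n = |Λ_L|`, `k = ⌈pn⌉`, `A = k/((n+1)(n−k+1))` (so `e^{lin} = A·v_k` and `effOf L k v = A·v`):
B2 gives `v_0 ≤ v_k (1 + (1+ε/2) A v_0)`, i.e. `A v_k ≥ X/(1 + (1+ε/2)X)` with `X = A v_0`; B1 gives
`v_0 ≥ 8n/(pε)`, and `A ≥ p/(4n)` (`k ≥ pn`, `(n+1)(n−k+1) ≤ 4n²`), so `X ≥ 2/ε` and
`A v_k ≥ (2/ε)/(1 + (1+ε/2)(2/ε)) = 1/(1+ε) ≥ 1 − ε`. Pure real algebra; no named facts, no `sorry`.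
The scaling-limit hypotheses of B are not used by the glue: (ρ, Δ, S) can only enter a proof of B2.
-/

noncomputable section

namespace Summit.CriticalPhenomena.Ising3DConformalLimit.PlantedPinningGaussianPinningSaturation

open scoped BigOperators Classical
open Finset MeasureTheory
open Literature.Probability.LatticeModels
open Summit.CriticalPhenomena.Ising3DConformalLimit.Theses.PlantedPinning

/-- **Stub B from its parts**: the `+` box susceptibility floor (B1) and the saturation of the
linear Riccati flow (B2) imply `TwoPointSaturation` (B): for every `ε > 0`, for `p` small and
`L ≥ L₀(p)`, `1 − ε ≤ e^{lin}_L(⌈p|Λ_L|⌉)`. Exact Riccati bookkeeping, see the module docstring. -/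
theorem twoPointSaturation_of_floor_of_riccati (h1 : BoxSusceptibilityFloor)
    (h2 : LinRiccatiSaturation) : TwoPointSaturation := by
  intro ρ Δ S _ _ _ _ _ ε hε
  obtain ⟨p₀, hp₀, hR⟩ := h2 (ε / 2) (by linarith)
  refine ⟨min p₀ 1, lt_min hp₀ one_pos, fun p hp hpp => ?_⟩
  have hp1 : p < 1 := lt_of_lt_of_le hpp (min_le_right _ _)
  obtain ⟨L₁, hL₁⟩ := hR p hp (lt_of_lt_of_le hpp (min_le_left _ _))
  obtain ⟨L₂, hL₂⟩ := h1 (8 / (p * ε))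
  refine ⟨max L₁ L₂, fun L hL => ?_⟩
  -- the two inputs at this `L`
  have hfl := hL₂ L (le_trans (le_max_right _ _) hL)
  have hRi := hL₁ L (le_trans (le_max_left _ _) hL)
  rw [← linVar_zero] at hfl
  -- notation and elementary bounds
  set n : ℕ := (box 3 L).card with hn
  set k : ℕ := ⌈p * (n : ℝ)⌉₊ with hk
  have hn1 : (1 : ℝ) ≤ n := by
    have : 0 < n := Finset.card_pos.2 ⟨0, by simp [mem_box]⟩
    exact_mod_cast this
  have hkn : k ≤ n := by
    refine Nat.ceil_le.2 ?_
    have h : p * (n : ℝ) ≤ 1 * (n : ℝ) := mul_le_mul_of_nonneg_right hp1.le (Nat.cast_nonneg _)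
    simpa using h
  have hkn' : (k : ℝ) ≤ n := by exact_mod_cast hkn
  have hpk : p * n ≤ k := Nat.le_ceil _
  have hD : (0 : ℝ) < ((n : ℝ) + 1) * ((n : ℝ) - k + 1) := mul_pos (by linarith) (by linarith)
  set v0 : ℝ := linVar L 0 with hv0
  set vk : ℝ := linVar L k with hvk
  set A : ℝ := (k : ℝ) / (((n : ℝ) + 1) * ((n : ℝ) - k + 1)) with hA
  have heff : ∀ v : ℝ, effOf L k v = A * v := fun v => by
    simp only [effOf, hA, ← hn]
    ring
  have hApos : 0 < A := div_pos (lt_of_lt_of_le (mul_pos hp (by linarith)) hpk) hD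
  -- `A ≥ p/(4n)` and `v0 ≥ 8n/(pε)`, so `A v0 ≥ 2/ε`
  have hv0pos : 0 < v0 := lt_of_lt_of_le (by positivity) hfl
  have hAv0 : 2 / ε ≤ A * v0 := by
    have hA' : p / (4 * n) ≤ A := by
      rw [hA, div_le_div_iff₀ (by positivity) hD]
      nlinarith [hpk, hkn', hn1, hp.le]
    calc 2 / ε = p / (4 * n) * (8 / (p * ε) * n) := by field_simp; ring
      _ ≤ A * v0 := mul_le_mul hA' hfl (by positivity) hApos.le
  -- the Riccati input: `v0 ≤ vk * (1 + (1+ε/2) A v0)`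
  rw [heff] at hRi
  have hB : 0 < 1 + (1 + ε / 2) * (A * v0) := by positivity
  -- goal `1 - ε ≤ linEff L k = A * vk`
  show 1 - ε ≤ linEff L k
  have hlin : linEff L k = A * vk := heff vk
  rw [hlin]
  have h3 : A * v0 ≤ A * vk * (1 + (1 + ε / 2) * (A * v0)) := by
    have := mul_le_mul_of_nonneg_left hRi hApos.le
    linarith [this]
  by_contra hcon
  push Not at hcon
  have h4 : A * vk * (1 + (1 + ε / 2) * (A * v0)) < (1 - ε) * (1 + (1 + ε / 2) * (A * v0)) :=
    mul_lt_mul_of_pos_right hcon hB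
  have hX := hAv0
  set X := A * v0 with hX'
  -- `X ≤ (1-ε)(1 + (1+ε/2)X)` forces `X·(ε/2)(1+ε) < 1 - ε`, contradicting `X ≥ 2/ε`
  have h5 : X < (1 - ε) * (1 + (1 + ε / 2) * X) := lt_of_le_of_lt h3 h4
  have h6 : 2 / ε * (ε / 2 * (1 + ε)) ≤ X * (ε / 2 * (1 + ε)) :=
    mul_le_mul_of_nonneg_right hX (by positivity)
  have h7 : 2 / ε * (ε / 2 * (1 + ε)) = 1 + ε := by field_simp
  nlinarith [h5, h6, h7, hε]

/-- Registered bookkeeping stub `stub_twoPointSaturationOfParts` (lead seat c1): the glue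
B ⟸ B1 ∧ B2, keyed by its registered name (= `twoPointSaturation_of_floor_of_riccati`). -/
theorem stub_twoPointSaturationOfParts :
    BoxSusceptibilityFloor → LinRiccatiSaturation → TwoPointSaturation :=
  twoPointSaturation_of_floor_of_riccati

end Summit.CriticalPhenomena.Ising3DConformalLimit.PlantedPinningGaussianPinningSaturation

end
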